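import Summits.Ventures.PercRepro.Night2TwoOneFatFaces

/-!
# PercRepro — the sources of a coloop-free target share one line: at most four of them (night-2, gen 29)

Let `S ⊆ G` with `S ∖ K` of rank `5` and WITHOUT coloops, and let `y₀ ∈ S` be such that `Q₀ = (S ∖ y₀) ∖ K` has the
structure of a lossy big covering set (`Night2OneFatFaces`): exactly three coloops `C₀`, the rest `R₀ = Q₀ ∖ C₀` of rank
`2` (a line) with at least three points.  Then every other point `y ∈ S` with the same structure lies in `C₀`:
* `y₀ ∉ cl (Q₀ ∖ w)` for `w ∈ C₀` (else `w` would be a coloop of `S ∖ K`);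
* for `y ∈ R₀` and `w ∈ C₀`, `(Q₀ ∖ w) ∖ y` still has rank `4` (`y` lies on the line spanned by the other points of
  `R₀`), so `((Q₀ ∖ w) ∖ y) ∪ {y₀}` has rank `5` and spans `w`: `w` is no coloop of `(S ∖ y) ∖ K`;
* hence the three coloops of `(S ∖ y) ∖ K` lie in `(R₀ ∖ y) ∪ {y₀}`, two of them `p ≠ p′` in `R₀`; a fourth point of
  `R₀` would put `p` in the closure of the others, and `|R₀| = 3` would make the rest `C₀` (rank `3`, independent) the
  line of `S ∖ y` (rank `2`).
So the sources of `S` are among the four points `C₀ ∪ {y₀}` (**`mem_coloops_of_source`**, **`card_sources_le_four`**).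

* `mem_clF_of_rkN_eq`: `X ⊆ Y`, `rk X = rk Y` ⇒ `Y ⊆ cl X`; `rkN_coloops_eq_card`: the coloops are independent;
* `rkN_erase_of_mem_coloops'`, `not_mem_coloops_of_rkN_erase_eq`.
-/

namespace PercRepro.Shadow

open Finset PerFlat ThmH

variable {α : Type*} [DecidableEq α] {M : Matroid α} [M.Finite] {G : Finset α}

section RankHelpers

/-- `X ⊆ Y ⊆ E` with `rk X = rk Y`: every point of `Y` lies in `cl X`. -/
theorem mem_clF_of_rkN_eq {X Y : Finset α} (hXY : X ⊆ Y) (hY : Y ⊆ gr M) (hr : rkN M X = rkN M Y) {a : α}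
    (ha : a ∈ Y) : a ∈ clF M X := by
  by_contra hcl
  have h1 := rkN_insert_of_notMem_clF (M := M) (hY ha) hcl
  have h2 : rkN M (insert a X) ≤ rkN M Y := rkN_mono (Finset.insert_subset ha hXY)
  omega

/-- The coloops of a set are independent: their rank is their number. -/
theorem rkN_coloops_eq_card {Y : Finset α} (hY : Y ⊆ gr M) : rkN M (coloops M Y) = (coloops M Y).card :=
  rkN_eq_card_of_indep (indep_coloops hY)

/-- A point of `Y` whose erasure keeps the rank is not a coloop. -/
theorem notMem_coloops_of_rkN_erase_eq {Y : Finset α} (hY : Y ⊆ gr M) {a : α} (ha : a ∈ Y)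
    (hr : rkN M (Y.erase a) = rkN M Y) : a ∉ coloops M Y := by
  intro hc
  exact (mem_coloops.1 hc).2 (mem_clF_of_rkN_eq (Finset.erase_subset a Y) hY hr ha)

/-- Two distinct points of a simple matroid have rank `2`. -/
theorem rkN_pair_eq_two (hs : ∀ e ∈ gr M, ∀ f ∈ gr M, e ≠ f → rkN M {e, f} = 2) {X : Finset α} (hX : X ⊆ gr M)
    {a b : α} (ha : a ∈ X) (hb : b ∈ X) (hab : a ≠ b) : 2 ≤ rkN M X := by
  have h := hs a (hX ha) b (hX hb) hab
  have hsub : ({a, b} : Finset α) ⊆ X := by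
    intro x hx
    rw [Finset.mem_insert, Finset.mem_singleton] at hx
    rcases hx with rfl | rfl
    · exact ha
    · exact hb
  have := rkN_mono (M := M) hsub
  omega

end RankHelpers

section Sources

/-- **A second source of a coloop-free target lies among the coloops of the first**: with `S ∖ K` of rank `5` and no
coloops, `y₀, y ∈ S` distinct, both `(S ∖ y₀) ∖ K` and `(S ∖ y) ∖ K` having three coloops and a rank-`2` rest of at
least three points, `y` is a coloop of `(S ∖ y₀) ∖ K`. -/
theorem mem_coloops_of_source (hG : G ∈ flatsQ M (5 + 1))
    (hs : ∀ e ∈ gr M, ∀ f ∈ gr M, e ≠ f → rkN M {e, f} = 2) {S : Finset α} (hSG : S ⊆ G)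
    (hS5 : rkN M (S \ coloops M G) = 5) (hc : coloops M (S \ coloops M G) = ∅) {y₀ y : α} (hy₀ : y₀ ∈ S)
    (hy : y ∈ S) (hne : y ≠ y₀)
    (hC₀ : (coloops M (S.erase y₀ \ coloops M G)).card = 3)
    (hR₀ : rkN M ((S.erase y₀ \ coloops M G) \ coloops M (S.erase y₀ \ coloops M G)) = 2)
    (hR₀3 : 3 ≤ ((S.erase y₀ \ coloops M G) \ coloops M (S.erase y₀ \ coloops M G)).card)
    (hC : (coloops M (S.erase y \ coloops M G)).card = 3)
    (hR : rkN M ((S.erase y \ coloops M G) \ coloops M (S.erase y \ coloops M G)) = 2) :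
    y ∈ coloops M (S.erase y₀ \ coloops M G) := by
  have hGg : G ⊆ gr M := (mem_flatsQ.1 hG).1
  set V := S \ coloops M G with hV
  have hVg : V ⊆ gr M := Finset.sdiff_subset.trans (hSG.trans hGg)
  have hVG : V ⊆ G \ coloops M G := Finset.sdiff_subset_sdiff hSG (Finset.Subset.refl _)
  -- neither `y₀` nor `y` is the coloop of `G`: erasing it would leave `V` itself, which has no coloops
  have hy₀K : y₀ ∉ coloops M G := by
    intro h
    have heq : S.erase y₀ \ coloops M G = V := by
      ext a
      simp only [Finset.mem_sdiff, Finset.mem_erase, hV]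
      constructor
      · rintro ⟨⟨-, ha⟩, haK⟩; exact ⟨ha, haK⟩
      · rintro ⟨ha, haK⟩; exact ⟨⟨fun h' => haK (h' ▸ h), ha⟩, haK⟩
    rw [heq, hc, Finset.card_empty] at hC₀
    omega
  have hyK : y ∉ coloops M G := by
    intro h
    have heq : S.erase y \ coloops M G = V := by
      ext a
      simp only [Finset.mem_sdiff, Finset.mem_erase, hV]
      constructor
      · rintro ⟨⟨-, ha⟩, haK⟩; exact ⟨ha, haK⟩
      · rintro ⟨ha, haK⟩; exact ⟨⟨fun h' => haK (h' ▸ h), ha⟩, haK⟩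
    rw [heq, hc, Finset.card_empty] at hC
    omega
  have hy₀V : y₀ ∈ V := Finset.mem_sdiff.2 ⟨hy₀, hy₀K⟩
  have hyV : y ∈ V := Finset.mem_sdiff.2 ⟨hy, hyK⟩
  have hQ₀ : S.erase y₀ \ coloops M G = V.erase y₀ := by
    ext a; simp only [Finset.mem_sdiff, Finset.mem_erase, hV]; tauto
  have hQ : S.erase y \ coloops M G = V.erase y := by
    ext a; simp only [Finset.mem_sdiff, Finset.mem_erase, hV]; tauto
  rw [hQ₀] at hC₀ hR₀ hR₀3 ⊢
  rw [hQ] at hC hR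
  set Q₀ := V.erase y₀ with hQ₀def
  set C₀ := coloops M Q₀ with hC₀def
  set R₀ := Q₀ \ C₀ with hR₀def
  have hQ₀g : Q₀ ⊆ gr M := (Finset.erase_subset _ _).trans hVg
  have hC₀Q : C₀ ⊆ Q₀ := fun w hw => (mem_coloops.1 hw).1
  have hQ₀5 : rkN M Q₀ = 5 := by
    -- `y₀` is not a coloop of `V`
    have hy₀c : y₀ ∉ coloops M V := by rw [hc]; exact Finset.notMem_empty _
    have h1 : y₀ ∈ clF M (V.erase y₀) := by
      by_contra h
      exact hy₀c (mem_coloops.2 ⟨hy₀V, h⟩)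
    have h2 := rkN_insert_le_of_mem_clF (M := M) hQ₀g h1
    rw [Finset.insert_erase hy₀V, hS5] at h2
    have h3 : rkN M Q₀ ≤ 5 := by rw [← hS5]; exact rkN_mono (Finset.erase_subset _ _)
    omega
  -- (a) `y₀ ∉ cl (Q₀ ∖ w)` for every coloop `w` of `Q₀`
  have ha : ∀ w ∈ C₀, y₀ ∉ clF M (Q₀.erase w) := by
    intro w hw hcl
    have hwQ : w ∈ Q₀ := hC₀Q hw
    have hwV : w ∈ V := (Finset.erase_subset _ _) hwQ
    have hwy₀ : w ≠ y₀ := (Finset.mem_erase.1 hwQ).1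
    have h4 : rkN M (Q₀.erase w) = 4 := by
      have := rkN_erase_of_mem_coloops (M := M) hQ₀g hw
      omega
    have h5 : rkN M (insert y₀ (Q₀.erase w)) ≤ 4 := by
      have := rkN_insert_le_of_mem_clF (M := M) ((Finset.erase_subset _ _).trans hQ₀g) hcl
      omega
    have heq : V.erase w = insert y₀ (Q₀.erase w) := by
      ext a
      simp only [Finset.mem_erase, Finset.mem_insert, hQ₀def]
      constructor
      · rintro ⟨haw, haV⟩
        by_cases hay : a = y₀
        · exact Or.inl hay
        · exact Or.inr ⟨haw, hay, haV⟩
      · rintro (rfl | ⟨haw, -, haV⟩)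
        · exact ⟨hwy₀.symm, hy₀V⟩
        · exact ⟨haw, haV⟩
    have hwc : w ∈ coloops M V := by
      rw [mem_coloops]
      refine ⟨hwV, fun hwcl => ?_⟩
      have h6 := rkN_insert_le_of_mem_clF (M := M) ((Finset.erase_subset _ _).trans hVg) hwcl
      rw [Finset.insert_erase hwV, hS5, heq] at h6
      omega
    rw [hc] at hwc
    exact Finset.notMem_empty _ hwc
  -- suppose `y ∉ C₀`; then `y ∈ R₀`
  by_contra hyC₀
  have hyQ₀ : y ∈ Q₀ := Finset.mem_erase.2 ⟨hne, hyV⟩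
  have hyR₀ : y ∈ R₀ := Finset.mem_sdiff.2 ⟨hyQ₀, hyC₀⟩
  have hR₀g : R₀ ⊆ gr M := Finset.sdiff_subset.trans hQ₀g
  -- `y` lies on the line spanned by the other points of `R₀`
  have hyline : y ∈ clF M (R₀.erase y) := by
    obtain ⟨p, hp, p', hp', hpp'⟩ := Finset.one_lt_card.1 (by
      rw [Finset.card_erase_of_mem hyR₀]; omega : 1 < (R₀.erase y).card)
    have h2 : 2 ≤ rkN M (R₀.erase y) :=
      rkN_pair_eq_two hs ((Finset.erase_subset _ _).trans hR₀g) hp hp' hpp'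
    have h2' : rkN M (R₀.erase y) ≤ 2 := by rw [← hR₀]; exact rkN_mono (Finset.erase_subset _ _)
    exact mem_clF_of_rkN_eq (Finset.erase_subset _ _) hR₀g (by omega) hyR₀
  set Q := V.erase y with hQdef
  have hQg : Q ⊆ gr M := (Finset.erase_subset _ _).trans hVg
  -- (b) no coloop of `Q₀` is a coloop of `Q`
  have hb : ∀ w ∈ C₀, w ∉ coloops M Q := by
    intro w hw hwc
    have hwQ₀ : w ∈ Q₀ := hC₀Q hw
    have hwV : w ∈ V := (Finset.erase_subset _ _) hwQ₀
    have hwy₀ : w ≠ y₀ := (Finset.mem_erase.1 hwQ₀).1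
    have hwy : w ≠ y := fun h => hyC₀ (h ▸ hw)
    have hwQ : w ∈ Q := Finset.mem_erase.2 ⟨hwy, hwV⟩
    -- `(Q₀ ∖ w) ∖ y` has rank `4`
    have h4 : rkN M (Q₀.erase w) = 4 := by
      have := rkN_erase_of_mem_coloops (M := M) hQ₀g hw
      omega
    have hyin : y ∈ clF M ((Q₀.erase w).erase y) := by
      refine clF_mono ?_ hyline
      intro a ha
      rw [Finset.mem_erase] at ha ⊢
      rw [Finset.mem_sdiff] at ha
      exact ⟨ha.1, Finset.mem_erase.2 ⟨fun h => ha.2.2 (h ▸ hw), ha.2.1⟩⟩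
    have hyQ₀w : y ∈ Q₀.erase w := Finset.mem_erase.2 ⟨hwy.symm, hyQ₀⟩
    have h4' : rkN M ((Q₀.erase w).erase y) = 4 := by
      have h1 := rkN_insert_le_of_mem_clF (M := M) ((Finset.erase_subset _ _).trans
        ((Finset.erase_subset _ _).trans hQ₀g)) hyin
      rw [Finset.insert_erase hyQ₀w, h4] at h1
      have h2 : rkN M ((Q₀.erase w).erase y) ≤ 4 := by rw [← h4]; exact rkN_mono (Finset.erase_subset _ _)
      omega
    -- adding `y₀` gives rank `5`
    have hy₀n : y₀ ∉ clF M ((Q₀.erase w).erase y) := fun h => ha w hw (clF_mono (Finset.erase_subset _ _) h)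
    have h5 := rkN_insert_of_notMem_clF (M := M) (hVg hy₀V) hy₀n
    rw [h4'] at h5
    have hsub : insert y₀ ((Q₀.erase w).erase y) ⊆ Q.erase w := by
      intro a hha
      rw [Finset.mem_insert] at hha
      rw [Finset.mem_erase, hQdef, Finset.mem_erase]
      rcases hha with rfl | hha
      · exact ⟨hwy₀.symm, hne.symm, hy₀V⟩
      · rw [Finset.mem_erase, Finset.mem_erase, hQ₀def, Finset.mem_erase] at hha
        exact ⟨hha.2.1, hha.1, hha.2.2.2⟩
    have h6 : 5 ≤ rkN M (Q.erase w) := by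
      have := rkN_mono (M := M) hsub
      omega
    have h7 : rkN M (Q.erase w) ≤ rkN M Q := rkN_mono (Finset.erase_subset _ _)
    have h8 : rkN M Q ≤ 5 := by rw [← hS5]; exact rkN_mono (Finset.erase_subset _ _)
    exact notMem_coloops_of_rkN_erase_eq hQg hwQ (by omega) hwc
  -- (c) the coloops of `Q` lie in `(R₀ ∖ y) ∪ {y₀}`
  set C := coloops M Q with hCdef
  have hCsub : C ⊆ insert y₀ (R₀.erase y) := by
    intro w hw
    have hwQ : w ∈ Q := (mem_coloops.1 hw).1
    rw [hQdef, Finset.mem_erase] at hwQ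
    rw [Finset.mem_insert]
    by_cases hwy₀ : w = y₀
    · exact Or.inl hwy₀
    · right
      have hwQ₀ : w ∈ Q₀ := Finset.mem_erase.2 ⟨hwy₀, hwQ.2⟩
      have hwC₀ : w ∉ C₀ := fun h => hb w h hw
      exact Finset.mem_erase.2 ⟨hwQ.1, Finset.mem_sdiff.2 ⟨hwQ₀, hwC₀⟩⟩
  -- two coloops `p ≠ p′` of `Q` in `R₀`
  have hCR : 2 ≤ (C ∩ R₀.erase y).card := by
    have h1 : C ⊆ insert y₀ (C ∩ R₀.erase y) := by
      intro w hw
      have := hCsub hw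
      rw [Finset.mem_insert] at this ⊢
      rcases this with h | h
      · exact Or.inl h
      · exact Or.inr (Finset.mem_inter.2 ⟨hw, h⟩)
    have h2 := Finset.card_le_card h1
    have h3 := Finset.card_insert_le y₀ (C ∩ R₀.erase y)
    omega
  obtain ⟨p, hp, p', hp', hpp'⟩ := Finset.one_lt_card.1 hCR
  rw [Finset.mem_inter, Finset.mem_erase] at hp hp'
  have hpR₀ : p ∈ R₀ := hp.2.2
  have hp'R₀ : p' ∈ R₀ := hp'.2.2
  have hpQ : p ∈ Q := (mem_coloops.1 hp.1).1
  have hp'Q : p' ∈ Q := (mem_coloops.1 hp'.1).1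
  -- (d) a fourth point of `R₀`
  by_cases h4 : 4 ≤ R₀.card
  · have hex : ∃ p'' ∈ R₀, p'' ≠ y ∧ p'' ≠ p ∧ p'' ≠ p' := by
      by_contra hno
      push Not at hno
      have hsub : R₀ ⊆ {y, p, p'} := by
        intro a hha
        rw [Finset.mem_insert, Finset.mem_insert, Finset.mem_singleton]
        by_contra hcon
        push Not at hcon
        exact hcon.2.2 (hno a hha hcon.1 hcon.2.1)
      have := Finset.card_le_card hsub
      have h3 : ({y, p, p'} : Finset α).card ≤ 3 := Finset.card_le_three
      omega
    obtain ⟨p'', hp''R₀, hp''y, hp''p, hp''p'⟩ := hex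
    have hp''Q : p'' ∈ Q := Finset.mem_erase.2 ⟨hp''y, (Finset.erase_subset _ _) (Finset.sdiff_subset hp''R₀)⟩
    -- `p ∈ cl {p′, p″} ⊆ cl (Q ∖ p)`
    have hpair : ({p', p''} : Finset α) ⊆ R₀ := by
      intro a hha
      rw [Finset.mem_insert, Finset.mem_singleton] at hha
      rcases hha with rfl | rfl
      · exact hp'R₀
      · exact hp''R₀
    have hr2 : rkN M ({p', p''} : Finset α) = 2 := hs p' (hR₀g hp'R₀) p'' (hR₀g hp''R₀) hp''p'.symm
    have hpcl : p ∈ clF M ({p', p''} : Finset α) :=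
      mem_clF_of_rkN_eq hpair hR₀g (by rw [hr2, hR₀]) hpR₀
    have hsub : ({p', p''} : Finset α) ⊆ Q.erase p := by
      intro a hha
      rw [Finset.mem_insert, Finset.mem_singleton] at hha
      rcases hha with rfl | rfl
      · exact Finset.mem_erase.2 ⟨hpp'.symm, hp'Q⟩
      · exact Finset.mem_erase.2 ⟨hp''p, hp''Q⟩
    exact (mem_coloops.1 hp.1).2 (clF_mono hsub hpcl)
  · -- `|R₀| = 3`: `R₀ = {y, p, p′}`, `C = {p, p′, y₀}` and the rest of `Q` is `C₀`, of rank `3`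
    have hc3 : ({y, p, p'} : Finset α) ⊆ R₀ := by
      intro b hb
      rw [Finset.mem_insert, Finset.mem_insert, Finset.mem_singleton] at hb
      rcases hb with rfl | rfl | rfl
      · exact hyR₀
      · exact hpR₀
      · exact hp'R₀
    have h3 : ({y, p, p'} : Finset α).card = 3 := by
      rw [Finset.card_insert_of_notMem, Finset.card_pair hpp']
      rw [Finset.mem_insert, Finset.mem_singleton]
      push Not
      exact ⟨hp.2.1.symm, hp'.2.1.symm⟩
    have hR₀eq : R₀ = {y, p, p'} :=
      (Finset.eq_of_subset_of_card_le hc3 (by rw [h3]; omega)).symm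
    -- `C ⊆ {p, p′, y₀}` with `|C| = 3`
    have hCeq : C = {y₀, p, p'} := by
      apply Finset.eq_of_subset_of_card_le
      · intro w hw
        have := hCsub hw
        rw [Finset.mem_insert] at this
        rw [Finset.mem_insert, Finset.mem_insert, Finset.mem_singleton]
        rcases this with h | h
        · exact Or.inl h
        · rw [Finset.mem_erase, hR₀eq, Finset.mem_insert, Finset.mem_insert, Finset.mem_singleton] at h
          rcases h.2 with h' | h' | h'
          · exact absurd h' h.1
          · exact Or.inr (Or.inl h')
          · exact Or.inr (Or.inr h')
      · rw [hC]; exact Finset.card_le_three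
    -- the rest of `Q` is `C₀`
    have hrest : Q \ C = C₀ := by
      ext a
      rw [Finset.mem_sdiff, hCeq, Finset.mem_insert, Finset.mem_insert, Finset.mem_singleton, hQdef,
        Finset.mem_erase]
      constructor
      · rintro ⟨⟨hay, haV⟩, hnot⟩
        push Not at hnot
        have haQ₀ : a ∈ Q₀ := Finset.mem_erase.2 ⟨hnot.1, haV⟩
        by_contra haC₀
        have haR₀ : a ∈ R₀ := Finset.mem_sdiff.2 ⟨haQ₀, haC₀⟩
        rw [hR₀eq, Finset.mem_insert, Finset.mem_insert, Finset.mem_singleton] at haR₀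
        rcases haR₀ with h | h | h
        · exact hay h
        · exact hnot.2.1 h
        · exact hnot.2.2 h
      · intro haC₀
        have haQ₀ : a ∈ Q₀ := hC₀Q haC₀
        rw [hQ₀def, Finset.mem_erase] at haQ₀
        have hay : a ≠ y := fun h => hyC₀ (h ▸ haC₀)
        refine ⟨⟨hay, haQ₀.2⟩, ?_⟩
        push Not
        refine ⟨haQ₀.1, fun h => ?_, fun h => ?_⟩
        · exact (Finset.mem_sdiff.1 hpR₀).2 (h ▸ haC₀)
        · exact (Finset.mem_sdiff.1 hp'R₀).2 (h ▸ haC₀)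
    have h3 : rkN M C₀ = 3 := by rw [rkN_coloops_eq_card hQ₀g, hC₀]
    rw [hrest, h3] at hR
    omega

end Sources

end PercRepro.Shadow
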